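import Mathlib
import Literature.AlgebraicGeometry.Resolution.BlowupStalkCharts
import Literature.AlgebraicGeometry.Resolution.BlowupPointSubalgebra
import HarnessLib

/-!
# The canonical embedding of the local rings of a blowing up into the function field

Topic: `Literature/AlgebraicGeometry/Resolution`. For a blowing up `ρ : C' → C` (`IsBlowup ρ J`,
`Blowups.lean`) of an integral locally Noetherian scheme `C`, every local ring `𝒪_{C',x'}` is a
localization of a chart `B_j = 𝒪_{C,ρ x'}[J/c_j]` of the blowing up of `Spec 𝒪_{C,ρ x'}`
(`IsBlowup.exists_reesChart_stalk`, `BlowupStalkCharts.lean`), hence (`BlowupPointSubalgebra.lean`)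
embeds CANONICALLY into the function field `K(C)`, compatibly with `𝒪_{C,ρ x'} → 𝒪_{C',x'}` and
`𝒪_{C,ρ x'} ⊆ K(C)`. This is the dictionary used to apply the `δ`-drop theorem
(`CurveDeltaDrop.lean`) to the points of the blowing up of a point of a curve (Kollár 2007,
§1.4; Cossart–Piltant 2008, proof of Prop. 4.4, steps 1–2). All PROVED:

* `IsBlowup.ringHom_ext_stalkMap` — two ring homomorphisms `𝒪_{C',x'} → A` to a domain which
  agree and are injective on `𝒪_{C,ρ x'}` coincide;
* `IsBlowup.stalkEmb` — **the canonical embedding `ε_{x'} : 𝒪_{C',x'} → K(C)`**: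
  `stalkEmb_comp_stalkMap` (`ε ∘ ρ^♯_{x'} = (𝒪_{C,ρ x'} ⊆ K(C))`), `stalkEmb_injective`,
  `stalkEmb_unique`, `stalkMap_injective` (`ρ^♯_{x'}` is injective);
* `IsBlowup.stalkEmb_comp_stalkSpecializes` — compatibility with specialization, and
  `IsBlowup.SpecMap_stalkEmb_fromSpecStalk` — the `K(C)`-points
  `Spec K(C) → Spec 𝒪_{C',x'} → C'` all coincide (with the one through the generic point);
  `SpecMap_algebraMap_fromSpecStalk`, `IsBlowup.SpecMap_stalkEmb_fromSpecStalk_comp` — and lie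
  over the canonical point `Spec K(C) → C`.

## Sources

* J. Kollár, *Lectures on Resolution of Singularities* (2007), §1.4. [Kollar2007]
* The Stacks Project, Tag 0804, Tag 01J7 (`Spec 𝒪_{X,x} → X`). [StacksProject]
-/

noncomputable section

open CategoryTheory AlgebraicGeometry TopologicalSpace IsLocalRing

namespace Literature.AlgebraicGeometry.Resolution

universe u

open Scheme.IdealSheafData

variable {C' C : Scheme.{u}} {ρ : C' ⟶ C} {J : C.IdealSheafData}

/-! ## Generators of the stalks of the centre -/

/-- The stalks of an ideal sheaf on a locally Noetherian scheme are generated by finitely many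
elements. [folklore] -/
theorem exists_fin_span_eq_stalkIdeal [IsLocallyNoetherian C] (J : C.IdealSheafData) (y : C) :
    ∃ (k : ℕ) (c : Fin k → C.presheaf.stalk y), Ideal.span (Set.range c) = stalkIdeal J y := by
  have hfg : (stalkIdeal J y).FG := IsNoetherian.noetherian _
  obtain ⟨k, c, hc⟩ := Submodule.fg_iff_exists_fin_generating_family.mp hfg
  exact ⟨k, c, hc⟩

/-! ## Ring homomorphisms out of the local rings of a blowing up -/

section Ext

/-- **Two ring homomorphisms `𝒪_{C',x'} → A` to a domain which agree on `𝒪_{C,ρ x'}` and are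
injective there coincide** (`𝒪_{C',x'}` is a localization of a chart `𝒪_{C,ρ x'}[J/c_j]`, on
which a homomorphism to a domain is determined by its restriction to `𝒪_{C,ρ x'}`).
[cite: StacksProject, Tag 0804] -/
theorem IsBlowup.ringHom_ext_stalkMap [IsLocallyNoetherian C] (hρ : IsBlowup ρ J) (x' : C')
    {A : Type*} [CommRing A] [IsDomain A] {g₁ g₂ : C'.presheaf.stalk x' →+* A}
    (h : g₁.comp (ρ.stalkMap x').hom = g₂.comp (ρ.stalkMap x').hom)
    (hinj : Function.Injective (g₁.comp (ρ.stalkMap x').hom)) : g₁ = g₂ := by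
  obtain ⟨k, c, hc⟩ := exists_fin_span_eq_stalkIdeal J (ρ x')
  obtain ⟨j, 𝔴, χ, hχ, hloc, -⟩ := hρ.exists_reesChart_stalk x' c hc
  letI := χ.toAlgebra
  haveI := hloc
  -- `B_j` is non-trivial, so `φ(c_j) ≠ 0` and `c_j ≠ 0`
  haveI : Nontrivial (chartRing c j) := ⟨⟨0, 1, fun h0 =>
    𝔴.isPrime.ne_top ((Ideal.eq_top_iff_one 𝔴.asIdeal).mpr (h0 ▸ 𝔴.asIdeal.zero_mem))⟩⟩
  have hφcj : chartBase c j (c j) ≠ 0 :=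
    nonZeroDivisors.ne_zero (reesChartBase_mem_nonZeroDivisors _ _)
  refine IsLocalization.ringHom_ext 𝔴.asIdeal.primeCompl (ringHom_ext_chartBase c j ?_ ?_)
  · ext a
    change g₁ (χ (chartBase c j a)) = g₂ (χ (chartBase c j a))
    rw [hχ]
    exact RingHom.congr_fun h a
  · change g₁ (χ (chartBase c j (c j))) ≠ 0
    rw [hχ]
    intro h0
    have hcj : c j = 0 := hinj (by rw [RingHom.comp_apply, h0, map_zero])
    exact hφcj ((congrArg (chartBase c j) hcj).trans (map_zero _))

end Ext

/-! ## The canonical embedding into the function field -/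

section Emb

variable [IsIntegral C] [IsLocallyNoetherian C]

/-- Existence of an injective ring homomorphism `𝒪_{C',x'} → K(C)` compatible with
`𝒪_{C,ρ x'} → K(C)`. [cite: Kollar2007, §1.4] -/
theorem IsBlowup.exists_stalk_ringHom (hρ : IsBlowup ρ J) (x' : C') :
    ∃ ε : C'.presheaf.stalk x' →+* C.functionField, Function.Injective ε ∧
      ε.comp (ρ.stalkMap x').hom = algebraMap (C.presheaf.stalk (ρ x')) C.functionField := by
  obtain ⟨k, c, hc⟩ := exists_fin_span_eq_stalkIdeal J (ρ x')
  obtain ⟨j, 𝔴, χ, hχ, hloc, -⟩ := hρ.exists_reesChart_stalk x' c hc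
  letI := χ.toAlgebra
  haveI := hloc
  haveI : Nontrivial (chartRing c j) := ⟨⟨0, 1, fun h0 =>
    𝔴.isPrime.ne_top ((Ideal.eq_top_iff_one 𝔴.asIdeal).mpr (h0 ▸ 𝔴.asIdeal.zero_mem))⟩⟩
  have hφcj : chartBase c j (c j) ≠ 0 :=
    nonZeroDivisors.ne_zero (reesChartBase_mem_nonZeroDivisors _ _)
  have hcj : c j ≠ 0 := fun h0 => hφcj ((congrArg (chartBase c j) h0).trans (map_zero _))
  refine ⟨locEmb C.functionField c j hcj 𝔴.asIdeal (C'.presheaf.stalk x'),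
    locEmb_injective C.functionField c j hcj 𝔴.asIdeal _, RingHom.ext fun a => ?_⟩
  rw [RingHom.comp_apply, ← hχ]
  exact locEmb_chartBase C.functionField c j hcj 𝔴.asIdeal _ a

/-- **The canonical embedding `ε_{x'} : 𝒪_{C',x'} → K(C)`** of a local ring of the blowing up
into the function field of the (integral) base. [cite: Kollar2007, §1.4] -/
def IsBlowup.stalkEmb (hρ : IsBlowup ρ J) (x' : C') : C'.presheaf.stalk x' →+* C.functionField :=
  (hρ.exists_stalk_ringHom x').choose

/-- `ε_{x'} ∘ ρ^♯_{x'} = (𝒪_{C,ρ x'} ⊆ K(C))`. [cite: Kollar2007, §1.4] -/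
theorem IsBlowup.stalkEmb_comp_stalkMap (hρ : IsBlowup ρ J) (x' : C') :
    (hρ.stalkEmb x').comp (ρ.stalkMap x').hom =
      algebraMap (C.presheaf.stalk (ρ x')) C.functionField :=
  (hρ.exists_stalk_ringHom x').choose_spec.2

/-- `ε_{x'} (ρ^♯ a) = a` in `K(C)`. [cite: Kollar2007, §1.4] -/
theorem IsBlowup.stalkEmb_stalkMap (hρ : IsBlowup ρ J) (x' : C') (a : C.presheaf.stalk (ρ x')) :
    hρ.stalkEmb x' ((ρ.stalkMap x').hom a) = algebraMap (C.presheaf.stalk (ρ x')) C.functionField a :=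
  RingHom.congr_fun (hρ.stalkEmb_comp_stalkMap x') a

/-- `ε_{x'}` is injective. [cite: Kollar2007, §1.4] -/
theorem IsBlowup.stalkEmb_injective (hρ : IsBlowup ρ J) (x' : C') :
    Function.Injective (hρ.stalkEmb x') :=
  (hρ.exists_stalk_ringHom x').choose_spec.1

/-- **Uniqueness of `ε_{x'}`** among ring homomorphisms to `K(C)` compatible with `𝒪_{C,ρ x'}`.
[cite: Kollar2007, §1.4] -/
theorem IsBlowup.stalkEmb_unique (hρ : IsBlowup ρ J) (x' : C')
    (g : C'.presheaf.stalk x' →+* C.functionField)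
    (hg : g.comp (ρ.stalkMap x').hom = algebraMap (C.presheaf.stalk (ρ x')) C.functionField) :
    g = hρ.stalkEmb x' :=
  hρ.ringHom_ext_stalkMap x' (hg.trans (hρ.stalkEmb_comp_stalkMap x').symm)
    (hg ▸ IsFractionRing.injective (C.presheaf.stalk (ρ x')) C.functionField)

/-- **`ρ^♯_{x'} : 𝒪_{C,ρ x'} → 𝒪_{C',x'}` is injective.** [folklore] -/
theorem IsBlowup.stalkMap_injective (hρ : IsBlowup ρ J) (x' : C') :
    Function.Injective (ρ.stalkMap x').hom := by
  intro a b h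
  apply IsFractionRing.injective (C.presheaf.stalk (ρ x')) C.functionField
  rw [← hρ.stalkEmb_stalkMap x' a, ← hρ.stalkEmb_stalkMap x' b, h]

omit [IsLocallyNoetherian C] in
/-- `(𝒪_{C,y} ⊆ K(C))` restricted along a specialization `y ⤳ z` is `(𝒪_{C,z} ⊆ K(C))`. [folklore] -/
theorem algebraMap_comp_stalkSpecializes {y z : C} (h : y ⤳ z) :
    (algebraMap (C.presheaf.stalk y) C.functionField).comp (C.presheaf.stalkSpecializes h).hom =
      algebraMap (C.presheaf.stalk z) C.functionField := by
  change ((C.presheaf.stalkSpecializes h) ≫ C.presheaf.stalkSpecializes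
    ((genericPoint_spec C).specializes (Set.mem_univ y))).hom = (C.presheaf.stalkSpecializes _).hom
  rw [TopCat.Presheaf.stalkSpecializes_comp]

/-- **Compatibility of `ε` with specialization**: `ε_{x'} ∘ (𝒪_{C',x''} → 𝒪_{C',x'}) = ε_{x''}`
for `x' ⤳ x''`. [cite: Kollar2007, §1.4] -/
theorem IsBlowup.stalkEmb_comp_stalkSpecializes (hρ : IsBlowup ρ J) {x' x'' : C'} (h : x' ⤳ x'') :
    (hρ.stalkEmb x').comp (C'.presheaf.stalkSpecializes h).hom = hρ.stalkEmb x'' := by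
  refine hρ.stalkEmb_unique x'' _ ?_
  rw [RingHom.comp_assoc]
  have hnat := ρ.stalkSpecializes_stalkMap x' x'' h
  have hnat' : (C'.presheaf.stalkSpecializes h).hom.comp (ρ.stalkMap x'').hom =
      (ρ.stalkMap x').hom.comp (C.presheaf.stalkSpecializes (ρ.base.hom.map_specializes h)).hom := by
    have := congrArg (fun f => CommRingCat.Hom.hom f) hnat
    simpa [CommRingCat.hom_comp] using this.symm
  rw [hnat', ← RingHom.comp_assoc, hρ.stalkEmb_comp_stalkMap, algebraMap_comp_stalkSpecializes]

omit [IsLocallyNoetherian C] in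
/-- The canonical morphism `Spec K(C) → Spec 𝒪_{C,y} → C` does not depend on `y`. [folklore] -/
theorem SpecMap_algebraMap_fromSpecStalk (y : C) :
    Spec.map (CommRingCat.ofHom (algebraMap (C.presheaf.stalk y) C.functionField)) ≫
      C.fromSpecStalk y = C.fromSpecStalk (genericPoint C) := by
  change Spec.map (C.presheaf.stalkSpecializes
    ((genericPoint_spec C).specializes (Set.mem_univ y))) ≫ C.fromSpecStalk y = _
  exact Scheme.SpecMap_stalkSpecializes_fromSpecStalk _

/-- **The `K(C)`-points `Spec K(C) → Spec 𝒪_{C',x'} → C'` all coincide.** [cite: Kollar2007, §1.4] -/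
theorem IsBlowup.SpecMap_stalkEmb_fromSpecStalk [IrreducibleSpace C'] (hρ : IsBlowup ρ J)
    (x' : C') :
    Spec.map (CommRingCat.ofHom (hρ.stalkEmb x')) ≫ C'.fromSpecStalk x' =
      Spec.map (CommRingCat.ofHom (hρ.stalkEmb (genericPoint C'))) ≫
        C'.fromSpecStalk (genericPoint C') := by
  have h : genericPoint C' ⤳ x' := (genericPoint_spec C').specializes (Set.mem_univ x')
  rw [← hρ.stalkEmb_comp_stalkSpecializes h, ← Scheme.SpecMap_stalkSpecializes_fromSpecStalk h,
    ← Category.assoc, ← Spec.map_comp]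
  rfl

/-- The `K(C)`-point of `C'` through `x'` lies over the canonical `K(C)`-point of `C`.
[cite: Kollar2007, §1.4] -/
theorem IsBlowup.SpecMap_stalkEmb_fromSpecStalk_comp (hρ : IsBlowup ρ J) (x' : C') :
    Spec.map (CommRingCat.ofHom (hρ.stalkEmb x')) ≫ C'.fromSpecStalk x' ≫ ρ =
      C.fromSpecStalk (genericPoint C) := by
  rw [← Scheme.SpecMap_stalkMap_fromSpecStalk, ← Category.assoc, ← Spec.map_comp,
    ← SpecMap_algebraMap_fromSpecStalk (ρ x')]
  congr 2
  ext a
  change hρ.stalkEmb x' ((ρ.stalkMap x').hom a) = _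
  exact hρ.stalkEmb_stalkMap x' a

end Emb

end Literature.AlgebraicGeometry.Resolution

end
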